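import Summits.Ventures.HodgeRepro.CongruenceHermitianLevel
import Summits.Ventures.HodgeRepro.BallGenJacobian

/-!
# R5 steps (2)–(4), local form, in ONE theorem on the rational points of any Hermitian form (seat p5)

Blind re-derivation cell `pub-hodge-repro`, seat `p5`.  Assembly of p5's `CongruenceHermitianLevel`
(congruence level + finite index of the iterated `Γ″`), `BallGenInvariance` (`Γ″`-invariance of the wedge of
translates), `BallGenJacobian` (Lemma W ⇒ a submersion on an open dense set) and typer-2's proved real
approximation `dense_ratPointsOf`.  ROUTE-C R5 / ROUTE.md A4 «Iteration (R5)», read with the eigenforms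
written as `dh_l` (`h_l` analytic on a neighbourhood of the ball, the lifts of the Albanese coordinates):

* **`lemmaW_submersion_congruenceCover_ratPointsOf`** — for `Γ(M) ≤ Γ′ ≤ U(H_K)(𝓞_K)`, `M ≠ 0`, transported
  to `U(p,1)`, and `p` functions `h_1, …, h_p` analytic near the ball, none locally constant on it, whose
  differential covector fields are `Γ′`-invariant, there are rational `γ_1, …, γ_p ∈ ratPointsOf` such that
  (i) on an OPEN DENSE set of points `z` of the ball the map `w ↦ (h_l(γ_l w))_l` is a submersion at `z`
  (it maps every neighbourhood of `z` onto a neighbourhood of its value), (ii) the `(p,0)`-form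
  `⋀_l γ_l^*(dh_l)` is invariant under `Γ″ = Γ′ ⊓ ⨅_l γ_l⁻¹ Γ′ γ_l`, (iii) `Γ″ ⊇ toUp(Γ(L))` for some `L ≠ 0`
  (a congruence subgroup), (iv) `Γ″` has finite index in `Γ′`.

What stays on paper: 13.2(a) (the eigenforms ARE the `dh_l` of the Albanese coordinates, `T`-equivariance),
13.2(c) (components), and the global half of 13.3(iv) (open image of the compact irreducible `S′` ⇒ all of
`A′`).

Nothing here says anything about the status of the Hodge conjecture for CM abelian varieties.
-/

set_option autoImplicit false

noncomputable section

namespace Summit.Ventures.HodgeRepro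

namespace CongHerm

open Matrix Filter Topology
open NumberField
open HodgeRepro.BallGen (Idx GLp U Ball unitaryGroupOf ratPointsOf pullback)
open HodgeRepro.BallGen.RealApprox (dense_ratPointsOf)
open HodgeRepro.BallGen.Inv (IsInvariant IsInvariantTop topForm isInvariantTop_topForm_pullback)
open HodgeRepro.BallGen.Holo (ballSet actE)
open HodgeRepro.BallGen.Subm (dcov)
open HodgeRepro.BallGen.Jacob (exists_submersion_on_dense)
open CongGen

variable {p : ℕ} {K : Type} [Field K] [NumberField K] [IsCMField K]
variable (HK : Matrix (Idx p) (Idx p) K) (φ₀ : K →+* ℂ) (P : GLp p)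
  (hP : (P : Matrix (Idx p) (Idx p) ℂ)ᴴ * HK.map φ₀ * (P : Matrix (Idx p) (Idx p) ℂ) = HodgeRepro.BallGen.J p)

/-- **R5 steps (2)–(4), local form, on the rational points of an arbitrary Hermitian form of signature
`(p,1)` over a CM field.**  Let `Γ(M) ≤ Γ′ ≤ U(H_K)(𝓞_K)`, `M ≠ 0`, be transported to `U(p,1)` by `toUp`, and
let `h_1, …, h_p` be analytic on a neighbourhood of the ball, none locally constant on it, with
`Γ′`-invariant differential covector fields `dh_l` (the lifts of `p` holomorphic 1-forms on `S_{Γ′}`).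
Then there are rational `γ_1, …, γ_p ∈ ratPointsOf` such that: on an open dense set of points `z` of the ball
the map `w ↦ (h_l(γ_l w))_l` maps every neighbourhood of `z` onto a neighbourhood of its value; the
`(p,0)`-form `⋀_l γ_l^*(dh_l)` is invariant under `Γ″ = Γ′ ⊓ ⨅_l γ_l⁻¹ Γ′ γ_l`; `Γ″` contains the transported
principal congruence subgroup `Γ(L)` for some `L ≠ 0`; and `Γ″` has finite index in `Γ′`. -/
theorem lemmaW_submersion_congruenceCover_ratPointsOf {Γ' : Subgroup (unitaryGroupOf HK)}
    (hΓ : Γ' ≤ arithU HK) {M : 𝓞 K} (hM0 : M ≠ 0) (hM : congrU HK M ≤ Γ')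
    {h : Fin p → (Fin p → ℂ) → ℂ} (hh : ∀ l, AnalyticOnNhd ℂ (h l) (ballSet p))
    (hh0 : ∀ l, ∃ w : Ball p, dcov (h l) w.1 ≠ 0)
    (hhΓ : ∀ l, IsInvariant (Γ'.map (toUp HK φ₀ P hP)) fun w : Ball p => dcov (h l) w.1) :
    ∃ γ : Fin p → U p, (∀ l, γ l ∈ ratPointsOf φ₀ HK P hP) ∧
      (∃ S : Set (Ball p), IsOpen S ∧ Dense S ∧ ∀ z ∈ S, ∀ U ∈ 𝓝 z.1,
        (fun w l => h l (actE (γ l) w)) '' U ∈ 𝓝 fun l => h l (actE (γ l) z.1)) ∧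
      IsInvariantTop (Γ'.map (toUp HK φ₀ P hP) ⊓ ⨅ l, conjSubG (γ l) (Γ'.map (toUp HK φ₀ P hP)))
        (topForm fun l => pullback (γ l) fun w : Ball p => dcov (h l) w.1) ∧
      (∃ L : 𝓞 K, L ≠ 0 ∧ (congrU HK L).map (toUp HK φ₀ P hP) ≤
        Γ'.map (toUp HK φ₀ P hP) ⊓ ⨅ l, conjSubG (γ l) (Γ'.map (toUp HK φ₀ P hP))) ∧
      (Γ'.map (toUp HK φ₀ P hP) ⊓ ⨅ l, conjSubG (γ l) (Γ'.map (toUp HK φ₀ P hP))).IsFiniteRelIndex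
        (Γ'.map (toUp HK φ₀ P hP)) := by
  obtain ⟨γ, hγ, S, hSo, hSd, hsub⟩ :=
    exists_submersion_on_dense (dense_ratPointsOf φ₀ HK P hP) hh hh0
  exact ⟨γ, hγ, ⟨S, hSo, hSd, hsub⟩, (isInvariantTop_topForm_pullback hhΓ γ).mono inf_le_right,
    exists_congrU_map_le_inf_iInf_conjSubG_ratPointsOf HK φ₀ P hP hM0 hM γ hγ,
    isFiniteRelIndex_inf_iInf_conjSubG_ratPointsOf HK φ₀ P hP hΓ hM0 hM γ hγ⟩

end CongHerm

end Summit.Ventures.HodgeRepro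

end
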